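import Literature.Computability.AlgebraicComplexity.RazElusiveGeneralResultOne
import Literature.Computability.AlgebraicComplexity.RazElusiveGeneralRouteProofs
import Literature.Computability.AlgebraicComplexity.RazMonomialCircuits
import HarnessLib

/-!
# Raz 2010, Cor. 5.8 = Cor. 1.14 and its corollaries — the discharges

Discharges (D-0014) of the named facts of `RazElusiveGeneral.lean`,
`RazElusiveGeneralRoute.lean` and `RazElusiveGeneralDefinable.lean` concerning R. Raz,
*Elusive functions and lower bounds for arithmetic circuits*, Theory of Computing 6 (2010)
135–177, assembled from the pieces already in the tree:

* `Raz2010_monomialCircuits_holds` — step 1 of the printed proof of Prop. 3.6 (p. 160),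
  invoked by Prop. 5.5 (p. 171): the poly(`n`)-size monomial-description circuit `C₁`, from
  its construction `RazMonomialCkt.descr` (`RazMonomialCircuits.lean`: `cktSize_descr`,
  `descrSize_le`, `descr_testBit_of_lt`, `sum_single_hotF`, `descr_testBit_of_ge`), with the
  size bound `p n = 1000 (n+1)⁵`;
* `Raz2010_prop_5_5_holds` — Prop. 5.5 (p. 171), by `Raz2010_prop_5_5_of_monomialCircuits`
  (`RazElusiveGeneralDefinable.lean`, steps 2–3 of the printed proof);
* `Raz2010_cor_5_8_holds` — **Cor. 5.8 = Cor. 1.14** (pp. 172, 147), by the printed proof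
  `Raz2010_cor_5_8_of_parts` (`RazElusiveGeneralRoute.lean`) from Prop. 5.5, Cor. 5.7
  (`Raz2010_cor_5_7_holds`, `RazElusiveGeneralRouteProofs.lean`) and Valiant's completeness of
  the permanent (`isVNPComplete_perPoly_holds`, `ValiantCompleteness.lean`);
* `Raz2010_result_1_holds` — §1 result 1 (p. 136), by `Raz2010_result_1_of_cor_5_8`
  (`RazElusiveGeneralResultOne.lean`);
* `Raz2010_elusive_curve_holds` — the abstract's curve statement with Raz's explicitness
  (`RazElusiveGeneral.lean`), by `Raz2010_elusive_curve_of_result_1`.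

All binders of the `_holds` theorems are the facts' own section parameters
`(F : Type u) [Field F]` (the facts are `def … (F) [Field F] : Prop`); nothing is assumed.

## References

* R. Raz, *Elusive functions and lower bounds for arithmetic circuits*, Theory of Computing 6
  (2010) 135–177: §1 result 1 (p. 136), Def. 1.3, Prop. 3.6 step 1 (p. 160), Prop. 5.5
  (p. 171), Cor. 5.7, Cor. 5.8 (p. 172) = Cor. 1.14 (p. 147).
* L. G. Valiant, *Completeness classes in algebra*, STOC 1979 (completeness of `PER`).
-/

noncomputable section

namespace Literature.Computability.AlgebraicComplexity

universe u

open Complexity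

/-- **Discharge of `Raz2010_monomialCircuits`** (Raz 2010, proof of Prop. 3.6, step 1, p. 160;
Prop. 5.5, p. 171): the circuit `RazMonomialCkt.descr n r` of `RazMonomialCircuits.lean` has
`≤ 1000 (n+1)⁵` gates for `1 ≤ r ≤ n` (`cktSize_descr`, `descrSize_le`), its rows on the bits of
`j < m` are the indicators of the blocks `hotF j a` of the stars of `h⁻¹(j)`
(`descr_testBit_of_lt`) which sum to `lexMonomial n r j` (`sum_single_hotF`), and it vanishes
on `m ≤ j < 2^K` (`descr_testBit_of_ge`).
[cite: Raz2010, proof of Prop. 3.6, step 1 (p. 160); Prop. 5.5 (p. 171)] -/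
theorem Raz2010_monomialCircuits_holds : Raz2010_monomialCircuits := by
  intro r
  refine ⟨fun n => 1000 * (n + 1) ^ 5,
    (IsPBounded.iff_exists_le_mul_succ_pow _).2 ⟨1000, 5, fun _ => le_rfl⟩, ?_⟩
  intro n h1 hrn
  have hn : 0 < n := by omega
  refine ⟨RazMonomialCkt.descr n (r n), fun i a => RazMonomialCkt.hotF n (r n) hn i a,
    (RazMonomialCkt.cktSize_descr n (r n) hn).of_le
      (RazMonomialCkt.descrSize_le n (r n) h1 hrn), ?_, ?_⟩
  · intro i hi
    exact ⟨fun a b => RazMonomialCkt.descr_testBit_of_lt hn hi a b,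
      RazMonomialCkt.sum_single_hotF hn hi⟩
  · intro i hmi hiK
    exact ⟨⟨0, h1⟩, fun b => RazMonomialCkt.descr_testBit_of_ge hmi hiK _⟩

/-- **Discharge of `Raz2010_prop_5_5`** (Raz 2010, Prop. 5.5, p. 171: `f` poly(`n`)-definable ⇒
`f̃` poly(`n`)-definable), from step 1 (`Raz2010_monomialCircuits_holds`) and steps 2–3 of
the printed proof (`Raz2010_prop_5_5_of_monomialCircuits`). The binders are the fact's own
parameters. [cite: Raz2010, Prop. 5.5 (p. 171)] -/
theorem Raz2010_prop_5_5_holds (F : Type u) [Field F] : Raz2010_prop_5_5 F :=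
  Raz2010_prop_5_5_of_monomialCircuits Raz2010_monomialCircuits_holds

/-- **Discharge of `Raz2010_cor_5_8`: Raz 2010, Corollary 5.8 = Corollary 1.14** (pp. 172,
147) — a poly(`n`)-definable `(s, 2)`-elusive `f : Fⁿ → F^{C(n+r-1, r)}` with
`s / C(n+r'-1, r') ≥ n^{ω(1)}` makes the permanent family over `F` (`char F ≠ 2`) not
p-computable — by the printed proof (`Raz2010_cor_5_8_of_parts`): Prop. 5.5
(`Raz2010_prop_5_5_holds`), Cor. 5.7 (`Raz2010_cor_5_7_holds`) and Valiant's
`VNP`-completeness of the permanent (`isVNPComplete_perPoly_holds`). The binders are the fact's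
own parameters. [cite: Raz2010, Cor. 5.8 (p. 172) = Cor. 1.14 (p. 147)] -/
theorem Raz2010_cor_5_8_holds (F : Type u) [Field F] : Raz2010_cor_5_8 F :=
  Raz2010_cor_5_8_of_parts (Raz2010_prop_5_5_holds F) Raz2010_cor_5_7_holds
    (isVNPComplete_perPoly_holds F)

/-- **Discharge of `Raz2010_result_1`** (Raz 2010, §1, result 1, p. 136: an explicit
`(s, 2)`-elusive `f : Fⁿ → F^m` with `m ≥ n^{ω(1)}`, `s ≥ m^{0.9}`, of degree poly(`n`), gives
super-polynomial circuit lower bounds for the permanent), by `Raz2010_result_1_of_cor_5_8`.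
The binders are the fact's own parameters. [cite: Raz2010, §1, result 1 (p. 136)] -/
theorem Raz2010_result_1_holds (F : Type u) [Field F] : Raz2010_result_1 F :=
  Raz2010_result_1_of_cor_5_8 (Raz2010_cor_5_8_holds F)

/-- **The abstract's curve statement, proved** (`Raz2010_elusive_curve`, the corrected form of
`raz_elusive_curve` with Raz's explicitness: an explicit curve family `F → F^{m(n)}`,
`m ≥ n^{ω(1)}`, of degree `< 2ⁿ`, eventually `(m-1, 2)`-elusive, refutes p-computability of the
permanent over `F`, `char F ≠ 2`), by `Raz2010_elusive_curve_of_result_1`. The binders are the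
statement's own parameters. [cite: Raz2010, abstract; §1 result 1 (p. 136); Prop. 1.2] -/
theorem Raz2010_elusive_curve_holds (F : Type u) [Field F] : Raz2010_elusive_curve F :=
  Raz2010_elusive_curve_of_result_1 (Raz2010_result_1_holds F)

end Literature.Computability.AlgebraicComplexity
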